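import Summits.QuantumFields.YangMills.Theorems.BalabanUVNodesPortZDStepRows
import Summits.QuantumFields.YangMills.Theorems.BalabanUVNodesN09FlatSectorUniqueness
import Literature.MathematicalPhysics.QuantumFieldTheory.Balaban1983to89.B15Prop1Thm1LetterLengthZero

/-!
# NODE O port, row PT-A′ helper lane (PTZ-1): the zero-input rows AT THE UNIT DATUM `W = 1` — the (0.19) ∕ (2.12) normalisation
# `𝓝⁰_{k+1}(1) = 𝓝_{k+1}(1) = 𝓓_{k+1}(1) = 𝐄_k(1) = 0` over the generic layer (χ, T BOUND), the [B11] clauses at the flat datum BY NAME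

[Balaban1987RG1] = [I] (CMP 109, 1987): (0.17) p. 255, (0.19) pp. 255–256 («log 𝐍_k⁻¹ … 𝐍_k given by the integral above with V = 1»),
(0.22) p. 256, (1.3) p. 260, (1.6) p. 261, (2.12) p. 268 («the normalization constant N_k^* is equal to the integral above at U_{k+1} = 1»);
[Balaban1985Variational] = [15] (CMP 102, 1985): Thm 1 p. 279, (4) p. 278.

Seat `ymgap-nodeO-port-PTZ-1` g0 (prover, HELPER MODE; every file `--supports stmt-QuantumFields-27930 --as helper`; nothing keyed to 26648).
Companion of `BalabanUVNodesPortZDStepRows` (this seat; `stepOutT_one`: `R_k(A)(1) = −A(Ū^k U_{k+1}(1))` for every input) with the [B11]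
side at the trivial datum supplied BY NAME from N09 w4's `BalabanUVNodesN09FlatSectorUniqueness` (`orbitRel_one_Uk_one`: `U_j(1)` is a residual
pure gauge; `flat_Uk_one`; every `ε > 0`, `j ≤ m + K`) and `B15Claim189UnitTestAtRecord.iter_avOfRecord_one` (`Ū^j 1 = 1`).  CRIT-1 Q-5 (β):
χ, T BOUND; where the value of the bare `Uk` is moved through `A_k` the row displays `GaugeInvariant (effActionHT … k)` (selection-free as
stated; its bare-record instance is Q-3-dependent and not taken).

WHAT IS PROVED (0 sorry, 0 def): `mainTermT_one` (`A⁰_k(1) = 0`), `wilsonAction4_Uk_iter_Uk_one` (`A(U_k(Ū^k U_{k+1}(1))) = 0`),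
`zeroInputMergedTermT_one` (`𝓝⁰_{k+1}(1) = 0` — the zero-input functional is NORMALISED, as every (1.18)-piece family of record must be at
the chart origin), `effActionHT_one` (`A_k(1) = 0`, every `k`, every transport: (0.17) at the unit ∕ `nextAction_one`), `EkT_one` (`𝐄_k(1) = 0`),
`mergedTermT_one_of_gaugeInvariant` ∕ `mergedTermT_one` (`𝓝_{k+1}(1) = 0` given `GaugeInvariant A_k`, resp. under
`B12EffectiveActionInvarianceT.gaugeInvariant_effActionHT`'s hypotheses), `dChannel_one` (`𝓓_{k+1}(1) = 0`).

HONEST FRAMING.  Kernel bookkeeping at one datum; the [B11] facts at `V = 1` are the cited tree theorems (flat sector), nothing of Bałaban's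
estimates is asserted, ported or discharged; 26648 UNSIGNED, 27930⁷ ∕ 27931⁷ OPEN; K0⁷ ∕ stub 2′ OPEN; counts unmoved; finite 𝕋⁴ at fixed ε —
NOT continuum ∕ OS ∕ Clay; the Yang–Mills mass gap is NOT proved by any of this.  No `sorry`, no `instance`, no `notation`, no `def`.
-/

noncomputable section

namespace Summit.QuantumFields.YangMills.Theorems.PortZD

open Literature.MathematicalPhysics.QuantumFieldTheory.Balaban1983to89
open Literature.MathematicalPhysics.QuantumFieldTheory.Balaban1983to89.Node00
open Literature.MathematicalPhysics.QuantumFieldTheory.Balaban1983to89.Node00.ZeroInput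
open Summit.QuantumFields.YangMills.BalabanUVNodes.N09FlatSectorUniqueness (orbitRel_one_Uk_one flat_Uk_one)
open B15Prop1Thm1LetterLengthZero (wilsonAction4_eq_zero_of_flat)
open B15Claim189UnitTestAtRecord (iter_avOfRecord_one)
open T4Continuum (T4Family)
open B12RTGaugeInvariance254 (LiftInvariant)
open B12EffectiveActionInvarianceT (gaugeInvariant_effActionHT)
open B16Sect1Backgrounds (toMS iter_gaugeAct)
open GaugeField (gaugeAct GaugeInvariant)

variable (F : T4Family) (N : ℕ) [NeZero N]

/-- **`A⁰_k(1) = 0`** (`ε > 0`): the chosen minimiser over the unit datum is plaquette-flat (`flat_Uk_one`), so its Wilson action vanishes.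
[cite: Balaban1987RG1, (1.3) p.260; Balaban1985Variational, (4) p.278] -/
theorem mainTermT_one {ε : ℝ} (hε : 0 < ε) (K : ℕ) (g : ℕ → ℝ) (k : ℕ) :
    mainTermT F N ε K g k 1 = 0 := by
  show -(1 / (g k) ^ 2) * wilsonAction4 (Uk F N K k ε 1) = 0
  rw [wilsonAction4_eq_zero_of_flat (flat_Uk_one (F := F) (N := N) k hε), mul_zero]

/-- **`A(U_k(Ū^k U_{k+1}(1))) = 0`** (`ε > 0`, `k + 1 ≤ m + K`): `U_{k+1}(1) = 1^u` with `u` residual (`orbitRel_one_Uk_one`), `Ū^k(1^u) = 1^{u↾T⁽ᵏ⁾}`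
(`iter_gaugeAct`, `iter_avOfRecord_one`), and the Wilson action of the chosen level-k minimiser does not see the coarse gauge transformation
(`PortZD.wilsonAction4_Uk_gaugeAct`), leaving `A(U_k(1)) = 0`. [cite: Balaban1987RG1, (0.21)–(0.22) p.256; Balaban1985Variational, Thm 1 p.279] -/
theorem wilsonAction4_Uk_iter_Uk_one {ε : ℝ} (hε : 0 < ε) {K k : ℕ} (hk : k + 1 ≤ (F.P K).m + (F.P K).K) :
    wilsonAction4 (Uk F N K k ε (Averaging.iter (avOfRecord F N K) k (Uk F N K (k + 1) ε 1))) = 0 := by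
  obtain ⟨u, -, hEq⟩ := orbitRel_one_Uk_one (F := F) (N := N) hk hε
  have hk' : k ≤ (F.P K).m + (F.P K).K := Nat.le_of_succ_le hk
  rw [hEq, iter_gaugeAct (avOfRecord F N K) u _ k hk', iter_avOfRecord_one F N K k, wilsonAction4_Uk_gaugeAct hk',
    wilsonAction4_eq_zero_of_flat (flat_Uk_one (F := F) (N := N) k hε)]

/-- **THE ZERO-INPUT FUNCTIONAL IS NORMALISED: `𝓝⁰_{k+1}(1) = 0`** (`ε > 0`, `k + 1 ≤ m + K`; every transport, every χ) — `𝐓_k(A⁰_k)(1) = 0` by the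
(0.19) normalisation and `A⁰_k(Ū^k U_{k+1}(1)) = 0` by the previous row; p. 268: *«N_k^* is equal to the integral above at U_{k+1} = 1»*.
[cite: Balaban1987RG1, (0.19) p.255–256, (2.12) p.268] -/
theorem zeroInputMergedTermT_one (T : Transport F N) (χ : (K : ℕ) → (ℕ → ℝ) → (k : ℕ) → Density (F.P K) k (SU N)) {ε : ℝ}
    (hε : 0 < ε) {K : ℕ} (g : ℕ → ℝ) {k : ℕ} (hk : k + 1 ≤ (F.P K).m + (F.P K).K) :
    zeroInputMergedTermT F N T χ ε K g k 1 = 0 := by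
  rw [zeroInputMergedTermT_eq_stepOut, stepOutT_one]
  show -(-(1 / (g k) ^ 2) * wilsonAction4 (Uk F N K k ε (Averaging.iter (avOfRecord F N K) k (Uk F N K (k + 1) ε 1)))) = 0
  rw [wilsonAction4_Uk_iter_Uk_one F N hε hk, mul_zero, neg_zero]

/-- **`A_k(1) = 0` FOR EVERY `k` AND EVERY TRANSPORT**: `A_0(1) = −(1∕g_0²)A(1) = 0` ((0.17), the unit is flat) and `A_{j+1}(1) = 𝐓_j(A_j)(1) = 0`
((0.19)'s normalisation, `B12Eq019ActionBody.nextAction_one`). [cite: Balaban1987RG1, (0.17) p.255, (0.19) p.255–256] -/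
theorem effActionHT_one (T : Transport F N) (χ : (K : ℕ) → (ℕ → ℝ) → (k : ℕ) → Density (F.P K) k (SU N)) (K : ℕ) (g : ℕ → ℝ) :
    ∀ k : ℕ, effActionHT F N T χ K g k 1 = 0
  | 0 => by
    rw [effActionHT_zero, B12Eq019ActionBody.wilsonTerm_apply]
    have h : wilsonAction4 (1 : GaugeField (F.P K) 0 (SU N)) = 0 :=
      wilsonAction4_eq_zero_of_flat (Summit.QuantumFields.YangMills.BalabanUVNodes.N09FlatSectorUniqueness.flat_one (N := N))
    unfold wilsonAction4 at h
    rw [h, mul_zero]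
  | k + 1 => by rw [effActionHT_succ, B12Eq019ActionBody.nextAction_one]

/-- **`𝐄_k(1) = 0`** (`ε > 0`): the accumulated small actions are normalised at the unit ((0.22) as a definition: `A_k(1) + (1∕g_k²)A(U_k(1)) = 0 + 0`).
[cite: Balaban1987RG1, (0.22) p.256] -/
theorem EkT_one (T : Transport F N) (χ : (K : ℕ) → (ℕ → ℝ) → (k : ℕ) → Density (F.P K) k (SU N)) {ε : ℝ} (hε : 0 < ε) (K : ℕ)
    (g : ℕ → ℝ) (k : ℕ) : EkT F N T χ ε K g k 1 = 0 := by
  unfold EkT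
  rw [effActionHT_one, wilsonAction4_eq_zero_of_flat (flat_Uk_one (F := F) (N := N) k hε), mul_zero, add_zero]

/-- **`𝓝_{k+1}(1) = 0` GIVEN `GaugeInvariant A_k`** (`ε > 0`, `k + 1 ≤ m + K`): `𝓝_{k+1}(1) = −A_k(Ū^k U_{k+1}(1)) = −A_k(1^{u↾T⁽ᵏ⁾}) = −A_k(1) = 0`
(`stepOutT_one`, `orbitRel_one_Uk_one`, `iter_gaugeAct`, `effActionHT_one`).  The invariance of `A_k` is DISPLAYED (CRIT-1 Q-5 (β): it holds over a
lift-covariant transport with lift-invariant χ — `mergedTermT_one` — and is not available at the bare record as vetted, Q-3).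
[cite: Balaban1987RG1, (1.6) p.261, (2.12) p.268, (2.16) p.269] -/
theorem mergedTermT_one_of_gaugeInvariant (T : Transport F N) (χ : (K : ℕ) → (ℕ → ℝ) → (k : ℕ) → Density (F.P K) k (SU N))
    {ε : ℝ} (hε : 0 < ε) {K : ℕ} (g : ℕ → ℝ) {k : ℕ} (hk : k + 1 ≤ (F.P K).m + (F.P K).K)
    (hinv : GaugeInvariant (effActionHT F N T χ K g k)) :
    mergedTermT F N T χ ε K g k 1 = 0 := by
  obtain ⟨u, -, hEq⟩ := orbitRel_one_Uk_one (F := F) (N := N) (ε := ε) hk hε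
  rw [mergedTermT_eq_stepOut, stepOutT_one, hEq, iter_gaugeAct (avOfRecord F N K) u _ k (Nat.le_of_succ_le hk),
    iter_avOfRecord_one F N K k, hinv, effActionHT_one, neg_zero]

/-- **`𝓝_{k+1}(1) = 0` OVER A LIFT-COVARIANT TRANSPORT WITH LIFT-INVARIANT χ** (the hypotheses of `B12EffectiveActionInvarianceT.gaugeInvariant_effActionHT`;
`ε > 0`, `k + 1 ≤ m + K`). [cite: Balaban1987RG1, (1.6) p.261, (2.12) p.268, (2.16) p.269] -/
theorem mergedTermT_one (T : Transport F N)
    (hT : ∀ K j, j + 1 ≤ (F.P K).m + (F.P K).K → ∀ ρ : Density (F.P K) j (SU N), LiftInvariant ρ → GaugeInvariant (T K j ρ))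
    (χ : (K : ℕ) → (ℕ → ℝ) → (k : ℕ) → Density (F.P K) k (SU N)) {ε : ℝ} (hε : 0 < ε) {K : ℕ} (g : ℕ → ℝ)
    (hχ : ∀ j, j + 1 ≤ (F.P K).m + (F.P K).K → LiftInvariant (χ K g j)) {k : ℕ} (hk : k + 1 ≤ (F.P K).m + (F.P K).K) :
    mergedTermT F N T χ ε K g k 1 = 0 :=
  mergedTermT_one_of_gaugeInvariant F N T χ hε g hk (gaugeInvariant_effActionHT F N T hT χ K g hχ k (Nat.le_of_succ_le hk))

/-- **THE DIFFERENCE FUNCTIONAL IS NORMALISED: `𝓓_{k+1}(1) = 𝓝_{k+1}(1) − 𝓝⁰_{k+1}(1) = 0`** given `GaugeInvariant A_k` (`ε > 0`, `k + 1 ≤ m + K`).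
[cite: Balaban1987RG1, (1.6) p.261, (2.12) p.268] -/
theorem dChannel_one (T : Transport F N) (χ : (K : ℕ) → (ℕ → ℝ) → (k : ℕ) → Density (F.P K) k (SU N)) {ε : ℝ} (hε : 0 < ε)
    {K : ℕ} (g : ℕ → ℝ) {k : ℕ} (hk : k + 1 ≤ (F.P K).m + (F.P K).K) (hinv : GaugeInvariant (effActionHT F N T χ K g k)) :
    mergedTermT F N T χ ε K g k 1 - zeroInputMergedTermT F N T χ ε K g k 1 = 0 := by
  rw [mergedTermT_one_of_gaugeInvariant F N T χ hε g hk hinv, zeroInputMergedTermT_one F N T χ hε g hk, sub_zero]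

end Summit.QuantumFields.YangMills.Theorems.PortZD

end
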